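import Summits.ResolutionOfSingularities.ResolutionOfSingularities.Theorems.EquisingularLiftEquisingularLiftNatDepthIsoHypPoint
import Summits.ResolutionOfSingularities.ResolutionOfSingularities.Theorems.EquisingularLiftEquisingularLiftNatStepLocality
import Summits.ResolutionOfSingularities.ResolutionOfSingularities.Theorems.EquisingularLiftEquisingularLiftNatTwoStepOpen
import HarnessLib

/-!
# [OURS] THE INTRINSIC BLOW-UP TOWER SATISFIES UNFOLDING AND LOCALITY — `IsoHypPoint` from finitely many singular points of finite intrinsic depth
# (cruxes `Theses.EquisingularLift.EquisingularLiftNat` / `…NatThree`, stmt-ResolutionOfSingularities-20038 / -20148)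

[OURS · leafhand-res-equisingularlift-10 g1, 2026-08-31; cell `pub/decomp-res`] AI-produced, weaker than expert review; NOT a statement of any manuscript;
nothing here proves resolution of singularities in positive characteristic.  DEF-FREE helper; no `sorry`; standard axioms; ZERO named hypotheses.

THE INTRINSIC TOWER, spelled without a definition: a family `D : ℕ → Π Γ, Γ → Prop` is «a blow-up tower» when, at closed points,

  `D 0 Γ y ↔` every blow-up of `Γ` at the reduced point `y` is regular over `y` (ONE-STEP),                                              (`hD0`)
  `D (d+1) Γ y ↔` every blow-up of `Γ` at `y` is regular over `y` except at finitely many closed points `z` with `∃ d' ≤ d, D d' Z z`.  (`hDsucc`)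

(The recursion determines `D` at closed points up to `↔`; a future `Defs` file defining the tower literally discharges `hD0` / `hDsucc` by `Iff.rfl`.
Depths: `A₁, A₂ ↦ 0`; `A₃, A₄, D₄ ↦ 1`; `A₅, A₆, D₅ ↦ 2`; … once the charts are verified.)

* ★★ `tower_loc` — every blow-up tower is LOCAL (`iff` along `ρ` an isomorphism over `U ∋ y`, closed `y₂ ↦ y`): induction on the level, base
  ✓ `PointChain.oneStepAt_iff_of_isIso_morphismRestrict` (p831200), step ✓ `PointChain.stepAt_iff_of_isIso_morphismRestrict` (p831284) with payload `∃ d' ≤ d, D d'`;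
* ★ `tower_step` — every blow-up tower UNFOLDS (level `0`: empty exceptional set; level `d + 1`: levels `≤ d < d + 1`);
* ★★★ `isoHypPoint_of_towerPoints` — **`k = k̄`, `H` integral, `ι : H ↪ ℙⁿ_k` a closed immersion, `D` a blow-up tower, the non-regular points of `H` a
  finite set `S` of points with closed images each of SOME finite `D`-level ⟹ `IsoHypPoint k n H ι`** (✓ `isoHypPoint_of_finiteDepthPoints`, p831199).

Honest label: closes no registered stub (the registered isolated residual carries `¬ IsoHypPoint`; this certifies further `H` it excludes: every integral
`H ⊆ ℙⁿ_k̄` whose finitely many singularities are resolved by finitely many rounds of closed-point blow-ups in the intrinsic sense).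

References: [StacksProject, Tags 080E, 02OS]; [Hartshorne1977, II Ex. 7.12, V 3.9]; [GortzWedhorn2020, Prop. 13.91] — through the cited tree files.
-/

set_option linter.dupNamespace false -- mandated namespace `Summit.<Summit>.<Problem>` of this single-conjunct summit

noncomputable section

open CategoryTheory CategoryTheory.Limits AlgebraicGeometry TopologicalSpace
open Literature.AlgebraicGeometry.Resolution Literature.AlgebraicGeometry.Motives
open AlgebraicGeometry.Scheme.IdealSheafData

namespace Summit.ResolutionOfSingularities.ResolutionOfSingularities.Cruxes.EquisingularLiftNat.Sections

/-- ★★ **EVERY BLOW-UP TOWER IS LOCAL ON THE BASE (`iff`).**  `D` a blow-up tower (`hD0`, `hDsucc`); `ρ : Γ₂ → Γ` an isomorphism over an open `U ∋ y`, `y` and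
`y₂ ↦ y` closed: `D d Γ y ↔ D d Γ₂ y₂`, for every level `d` — strong induction on `d`: level `0` by ✓ `PointChain.oneStepAt_iff_of_isIso_morphismRestrict`,
level `d + 1` by ✓ `PointChain.stepAt_iff_of_isIso_morphismRestrict` for the payload `∃ d' ≤ d, D d'`, local by induction. [OURS] [cite: GortzWedhorn2020, (13.19)] -/
theorem tower_loc (D : ℕ → ∀ Γ : Scheme.{0}, Γ → Prop)
    (hD0 : ∀ (Γ : Scheme.{0}) (y : Γ), IsClosed (({y} : Set Γ)) →
      (D 0 Γ y ↔ ∀ (hy : IsClosed (({y} : Set Γ))) (Z : Scheme.{0}) (τ : Z ⟶ Γ), IsBlowup τ (vanishingIdeal ⟨{y}, hy⟩) →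
        ∀ z : Z, τ z = y → IsRegularLocalRing (Z.presheaf.stalk z)))
    (hDsucc : ∀ (d : ℕ) (Γ : Scheme.{0}) (y : Γ), IsClosed (({y} : Set Γ)) →
      (D (d + 1) Γ y ↔ ∀ (hy : IsClosed (({y} : Set Γ))) (Z : Scheme.{0}) (τ : Z ⟶ Γ), IsBlowup τ (vanishingIdeal ⟨{y}, hy⟩) →
        ∃ S' : Finset Z, (∀ z : Z, τ z = y → z ∉ S' → IsRegularLocalRing (Z.presheaf.stalk z)) ∧
          ∀ z ∈ S', τ z = y ∧ IsClosed (({z} : Set Z)) ∧ ∃ d' ≤ d, D d' Z z)) :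
    ∀ (d : ℕ), ∀ (Γ Γ₂ : Scheme.{0}) (ρ : Γ₂ ⟶ Γ) (U : Γ.Opens), IsIso (ρ ∣_ U) → ∀ y : Γ, y ∈ U → IsClosed (({y} : Set Γ)) →
      ∀ y₂ : Γ₂, ρ y₂ = y → IsClosed (({y₂} : Set Γ₂)) → (D d Γ y ↔ D d Γ₂ y₂) := by
  intro d
  induction d using Nat.strong_induction_on with
  | _ d ih =>
  intro Γ Γ₂ ρ U hρ y hyU hy y₂ hy₂ hy₂cl
  haveI := hρ
  cases d with
  | zero =>
    -- level `0`: one-step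
    rw [hD0 Γ y hy, hD0 Γ₂ y₂ hy₂cl]
    constructor
    · intro h hy₂' Z τ hτ
      exact (PointChain.oneStepAt_iff_of_isIso_morphismRestrict ρ U hyU hy hy₂ hy₂').mp (h hy) Z τ hτ
    · intro h hy' Z τ hτ
      exact (PointChain.oneStepAt_iff_of_isIso_morphismRestrict ρ U hyU hy' hy₂ hy₂cl).mpr (h hy₂cl) Z τ hτ
  | succ e =>
    -- level `e + 1`: the step with payload `∃ d' ≤ e, D d'`, local by induction
    rw [hDsucc e Γ y hy, hDsucc e Γ₂ y₂ hy₂cl]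
    have hE : ∀ (Z Z₂ : Scheme.{0}) (σ : Z₂ ⟶ Z) (W : Z.Opens), IsIso (σ ∣_ W) → ∀ z : Z, z ∈ W → IsClosed (({z} : Set Z)) →
        ∀ z₂ : Z₂, σ z₂ = z → IsClosed (({z₂} : Set Z₂)) → ((∃ d' ≤ e, D d' Z z) ↔ ∃ d' ≤ e, D d' Z₂ z₂) := by
      intro Z Z₂ σ W hσ z hzW hz z₂ hz₂ hz₂cl
      refine exists_congr fun d' => and_congr_right fun hd' => ?_
      exact ih d' (by omega) Z Z₂ σ W hσ z hzW hz z₂ hz₂ hz₂cl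
    constructor
    · intro h hy₂' Z τ hτ
      exact (PointChain.stepAt_iff_of_isIso_morphismRestrict (fun Z z => ∃ d' ≤ e, D d' Z z) hE ρ U hyU hy hy₂ hy₂').mp (h hy) Z τ hτ
    · intro h hy' Z τ hτ
      exact (PointChain.stepAt_iff_of_isIso_morphismRestrict (fun Z z => ∃ d' ≤ e, D d' Z z) hE ρ U hyU hy' hy₂ hy₂cl).mpr (h hy₂cl) Z τ hτ

/-- ★ **EVERY BLOW-UP TOWER UNFOLDS**: a blow-up at a level-`0` closed point is regular over it (empty exceptional set); a blow-up at a level-`(d+1)` closed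
point is regular over it except at finitely many closed points of levels `≤ d < d + 1`. [OURS] -/
theorem tower_step (D : ℕ → ∀ Γ : Scheme.{0}, Γ → Prop)
    (hD0 : ∀ (Γ : Scheme.{0}) (y : Γ), IsClosed (({y} : Set Γ)) →
      (D 0 Γ y ↔ ∀ (hy : IsClosed (({y} : Set Γ))) (Z : Scheme.{0}) (τ : Z ⟶ Γ), IsBlowup τ (vanishingIdeal ⟨{y}, hy⟩) →
        ∀ z : Z, τ z = y → IsRegularLocalRing (Z.presheaf.stalk z)))
    (hDsucc : ∀ (d : ℕ) (Γ : Scheme.{0}) (y : Γ), IsClosed (({y} : Set Γ)) →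
      (D (d + 1) Γ y ↔ ∀ (hy : IsClosed (({y} : Set Γ))) (Z : Scheme.{0}) (τ : Z ⟶ Γ), IsBlowup τ (vanishingIdeal ⟨{y}, hy⟩) →
        ∃ S' : Finset Z, (∀ z : Z, τ z = y → z ∉ S' → IsRegularLocalRing (Z.presheaf.stalk z)) ∧
          ∀ z ∈ S', τ z = y ∧ IsClosed (({z} : Set Z)) ∧ ∃ d' ≤ d, D d' Z z)) :
    ∀ (d : ℕ) (Γ : Scheme.{0}) (y : Γ), D d Γ y → ∀ (hy : IsClosed (({y} : Set Γ))) (Z : Scheme.{0}) (τ : Z ⟶ Γ), IsBlowup τ (vanishingIdeal ⟨{y}, hy⟩) →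
        ∃ S' : Finset Z, (∀ z : Z, τ z = y → z ∉ S' → IsRegularLocalRing (Z.presheaf.stalk z)) ∧
          ∀ z ∈ S', τ z = y ∧ IsClosed (({z} : Set Z)) ∧ ∃ d' < d, D d' Z z := by
  classical
  intro d Γ y hD hy Z τ hτ
  cases d with
  | zero =>
    refine ⟨∅, fun z hz _ => (hD0 Γ y hy).mp hD hy Z τ hτ z hz, fun z hz => absurd hz (Finset.notMem_empty z)⟩
  | succ e =>
    obtain ⟨S', hreg, hS'⟩ := (hDsucc e Γ y hy).mp hD hy Z τ hτ
    refine ⟨S', hreg, fun z hz => ?_⟩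
    obtain ⟨hτz, hzcl, d', hd', hDz⟩ := hS' z hz
    exact ⟨hτz, hzcl, d', by omega, hDz⟩

/-- ★★★ **FINITELY MANY SINGULAR POINTS OF FINITE INTRINSIC BLOW-UP DEPTH ⟹ `IsoHypPoint`** (the lead's hypothesis #7 = `PointResolvable`).  `k` algebraically
closed, `H` integral, `ι : H ↪ ℙⁿ_k` a closed immersion, `D` a blow-up tower (`hD0`, `hDsucc`); `S` a finite set of points of `H` with closed images such that `H`
is regular exactly off `S` and every `x ∈ S` has some `D`-level.  Then `IsoHypPoint k n H ι` (✓ `isoHypPoint_of_finiteDepthPoints` with `tower_step`,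
`tower_loc`). [OURS] [cite: StacksProject, Tag 080E] [cite: Hartshorne1977, II Ex. 7.12] -/
theorem isoHypPoint_of_towerPoints (k : Type) [Field k] [IsAlgClosed k] (n : ℕ) (H : Scheme.{0})
    (ι : H ⟶ (projectiveSpace n k).left) [IsClosedImmersion ι] [IsIntegral H]
    (D : ℕ → ∀ Γ : Scheme.{0}, Γ → Prop)
    (hD0 : ∀ (Γ : Scheme.{0}) (y : Γ), IsClosed (({y} : Set Γ)) →
      (D 0 Γ y ↔ ∀ (hy : IsClosed (({y} : Set Γ))) (Z : Scheme.{0}) (τ : Z ⟶ Γ), IsBlowup τ (vanishingIdeal ⟨{y}, hy⟩) →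
        ∀ z : Z, τ z = y → IsRegularLocalRing (Z.presheaf.stalk z)))
    (hDsucc : ∀ (d : ℕ) (Γ : Scheme.{0}) (y : Γ), IsClosed (({y} : Set Γ)) →
      (D (d + 1) Γ y ↔ ∀ (hy : IsClosed (({y} : Set Γ))) (Z : Scheme.{0}) (τ : Z ⟶ Γ), IsBlowup τ (vanishingIdeal ⟨{y}, hy⟩) →
        ∃ S' : Finset Z, (∀ z : Z, τ z = y → z ∉ S' → IsRegularLocalRing (Z.presheaf.stalk z)) ∧
          ∀ z ∈ S', τ z = y ∧ IsClosed (({z} : Set Z)) ∧ ∃ d' ≤ d, D d' Z z))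
    (S : Finset H)
    (hcl : ∀ x ∈ S, IsClosed (({ι x} : Set (projectiveSpace n k).left)))
    (hsing : ∀ x ∈ S, ¬ IsRegularLocalRing (H.presheaf.stalk x))
    (hreg : ∀ x : H, x ∉ S → IsRegularLocalRing (H.presheaf.stalk x))
    (hdepth : ∀ x ∈ S, ∃ d, D d H x) :
    IsoHypPoint k n H ι :=
  isoHypPoint_of_finiteDepthPoints k n H ι D (tower_step D hD0 hDsucc) (tower_loc D hD0 hDsucc) S hcl hsing hreg hdepth

end Summit.ResolutionOfSingularities.ResolutionOfSingularities.Cruxes.EquisingularLiftNat.Sections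

end
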